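import Mathlib
import Literature.Combinatorics.Enumerative.AperyNumbers
import Literature.Combinatorics.Enumerative.AperyNumbersZetaTwo
import HarnessLib

/-!
# Leading coefficients of Brown's cellular integral `₈π₆` and their supercongruence (McCarthy–Osburn–Straub 2020)

Topic `Literature/NumberTheory/Irrationality` (Brown's programme: cellular integrals on `M_{0,N}`). Typed, cited statements (named
facts, no proofs; D-0014) with DEFINITIONS and kernel checks, read on the page (this session) from D. McCarthy, R. Osburn, A. Straub,
*Sequences, modular forms and cellular integrals*, Math. Proc. Cambridge Philos. Soc. 168 (2020) 379–404 = arXiv:1705.05586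
[MccarthyOsburnStraub2018] (locators = arXiv numbering), together with the two classical Apéry-number supercongruences it
generalises, (1.2) = [Ahlgren2001] and (1.3) = [AhlgrenOno2000], as restated there.

HONEST FRAMING (cell zeta5-irr): records of the literature on the ARITHMETIC of leading coefficients of cellular integrals (the
`ζ(2)`/`ζ(3)` Apéry numbers are the cases `N = 5, 6`; `₈π₆ = (8,3,6,1,4,7,2,5)` is the self-dual convergent configuration on
`M_{0,8}` whose integrals are linear forms in `1, ζ(3), ζ(5)` and `ζ(2)ζ(3)`-free after Brown's duality); no irrationality statement
is made or implied. The Summit-side census `Summits/KontsevichZagierPeriods/Zeta5Search/Brown8/LeadingCoefficients*.lean` cites this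
paper for its binomial sums; this file gives the printed anchor a name.

## What is printed

* §1 (p. 3): "`a(n) = Σ_{k=0}^{n} binom(n,k)² binom(n+k,k)`, `b(n) = Σ_{k=0}^{n} binom(n,k)² binom(n+k,k)²` are the Apéry numbers"
  (tree: `AperyNumbersZetaTwo.apery2Number`, `AperyNumbers.aperyNumber`); "`η^6(4z) =: Σ_{n≥1} α(n) qⁿ`, the unique newform in
  `S_3(Γ_0(16), (−4/·))`, where `η(z) = q^{1/24} ∏_{n≥1} (1 − qⁿ)` … Ahlgren showed that, for all primes `p ≥ 5`,
  (1.2) `a((p−1)/2) ≡ α(p) (mod p²)` … Ahlgren and Ono proved … if `p` is an odd prime, then (1.3) `b((p−1)/2) ≡ β(p) (mod p²)`,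
  where `η^4(2z) η^4(4z) =: Σ β(n) qⁿ` is the unique newform in `S_4(Γ_0(8))`."
* §1 (p. 4): for a convergent `σ = σ_N`, `I_σ(n) = ∫_{S_N} f_σⁿ ω_σ = a^{(N−3)}_{n,σ} ζ_{N−3} + … + a^{(0)}_{n,σ} ζ_0`, normalised by
  `a^{(N−3)}_{0,σ} = 1`, and `A_σ(n) := a^{(N−3)}_{n,σ}` is "the leading coefficient" ("leading coefficients are only well-defined if
  multiple zeta values of different weight are linearly independent over `ℚ` which, unfortunately, remains open. Since we will be
  concerned with specific permutations `σ`, in which case suitable coefficients can be made explicit, this issue will not disturb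
  our discussion"). `N = 5`: `A_{σ_5}(n) = a(n)`; `N = 6`: `A_{σ_6}(n) = b(n)`.
* **Theorem 1.2** (p. 4). "Let `p` be an odd prime. Then `A_{σ_8}((p−1)/2) ≡ γ(p) (mod p²)`", where `σ_8 = (8,3,6,1,4,7,2,5)` and
  "`η^{12}(2z) =: Σ_{n≥1} γ(n) qⁿ`, the unique newform in `S_6(Γ_0(4))`".
* **Proposition 3.1** (p. 9). "For the configuration `σ_8 = (8,3,6,1,4,7,2,5)`, the leading coefficients are
  `A_{σ_8}(n) = Σ_{k_1,k_2,k_3,k_4 = 0, k_1+k_2 = k_3+k_4}^{n} ∏_{i=1}^{4} binom(n,k_i) binom(n+k_i,k_i)`", with "initial terms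
  `1, 33, 8929, 4124193, 2435948001, 1657775448033, …`"; Remark 3.2: `A_{σ_8}` "is the unique solution of a fourth order recurrence"
  with polynomial coefficients of degree 15 satisfying `p_j(n) = −p_{4−j}(−5−n)` (coefficients not printed — not typed).
* Theorem 1.1 (every odd `N ≥ 5`: some convergent `σ_N` and a CM form of weight `N − 2` with `A_{σ_N}((p−1)/2) ≡ γ_k(p) (mod p²)`,
  `p ≥ 5`) and Conjecture 1.3 (`A_{σ_N}(mp^r) ≡ A_{σ_N}(mp^{r−1}) (mod p^{3r})`, OPEN) are recorded here, not typed.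

## What is typed

Since "the leading coefficient of `I_{σ_8}(n)`" is not a definable real invariant (see the caveat quoted above), `leadSigma8` IS the
printed binomial sum of Proposition 3.1 (the paper's working definition of `A_{σ_8}` in §§3–5), with the printed initial terms as a
kernel check; `eta12TwoCoeff`, `eta6FourCoeff`, `eta44Coeff` are the `q`-expansion coefficients of `η^{12}(2z)`, `η^6(4z)`,
`η^4(2z)η^4(4z)` written as coefficients of the (harmlessly over-)truncated products; the three supercongruences are NAMED FACTS.
-/

open Finset Polynomial

namespace Literature.NumberTheory.Irrationality.McCarthyOsburnStraub2020

/-- The leading coefficients `A_{σ_8}(n)` of the cellular integrals of the self-dual configuration `σ_8 = ₈π₆ = (8,3,6,1,4,7,2,5)`,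
as the printed symmetric binomial sum `Σ_{0 ≤ k_i ≤ n, k_1+k_2 = k_3+k_4} ∏_{i=1}^{4} binom(n,k_i) binom(n+k_i,k_i)`.
[cite: MccarthyOsburnStraub2018, Proposition 3.1 (p. 9)] -/
def leadSigma8 (n : ℕ) : ℕ :=
  ∑ k₁ ∈ range (n + 1), ∑ k₂ ∈ range (n + 1), ∑ k₃ ∈ range (n + 1), ∑ k₄ ∈ range (n + 1),
    if k₁ + k₂ = k₃ + k₄ then
      (n.choose k₁ * (n + k₁).choose k₁) * (n.choose k₂ * (n + k₂).choose k₂) *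
        ((n.choose k₃ * (n + k₃).choose k₃) * (n.choose k₄ * (n + k₄).choose k₄))
    else 0

/-- Kernel check of the printed initial terms `1, 33, 8929, 4124193`. [cite: MccarthyOsburnStraub2018, §3.1 (p. 9)] -/
theorem leadSigma8_values :
    [leadSigma8 0, leadSigma8 1, leadSigma8 2, leadSigma8 3] = [1, 33, 8929, 4124193] := by decide

/-- `γ(n)`: the coefficient of `qⁿ` in `η^{12}(2z) = q ∏_{m ≥ 1} (1 − q^{2m})^{12}` (the unique newform in `S_6(Γ_0(4))`), computed from
the product truncated at `m ≤ n` (factors with `2m ≥ n` do not affect the coefficient of `qⁿ`).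
[cite: MccarthyOsburnStraub2018, §1 (p. 4, before Theorem 1.2)] -/
noncomputable def eta12TwoCoeff (n : ℕ) : ℤ :=
  ((X : ℤ[X]) * ∏ m ∈ Icc 1 n, (1 - X ^ (2 * m)) ^ 12).coeff n

/-- `α(n)`: the coefficient of `qⁿ` in `η^6(4z) = q ∏_{m ≥ 1} (1 − q^{4m})^6` (the unique newform in `S_3(Γ_0(16), (−4/·))`), from the
product truncated at `m ≤ n`. [cite: MccarthyOsburnStraub2018, §1 (p. 3, eq. before (1.2))] -/
noncomputable def eta6FourCoeff (n : ℕ) : ℤ :=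
  ((X : ℤ[X]) * ∏ m ∈ Icc 1 n, (1 - X ^ (4 * m)) ^ 6).coeff n

/-- `β(n)`: the coefficient of `qⁿ` in `η^4(2z) η^4(4z) = q ∏_{m ≥ 1} (1 − q^{2m})^4 (1 − q^{4m})^4` (the unique newform in `S_4(Γ_0(8))`),
from the product truncated at `m ≤ n`. [cite: MccarthyOsburnStraub2018, §1 (p. 3, eq. after (1.3))] -/
noncomputable def eta44Coeff (n : ℕ) : ℤ :=
  ((X : ℤ[X]) * ∏ m ∈ Icc 1 n, ((1 - X ^ (2 * m)) ^ 4 * (1 - X ^ (4 * m)) ^ 4)).coeff n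

/-- **McCarthy–Osburn–Straub 2020, Theorem 1.2** (named fact, statement only): "Let `p` be an odd prime. Then
`A_{σ_8}((p−1)/2) ≡ γ(p) (mod p²)`" (`A_{σ_8}` = `leadSigma8` by Proposition 3.1, `γ` = `eta12TwoCoeff`).
[cite: MccarthyOsburnStraub2018, Theorem 1.2 (p. 4); Proposition 3.1 (p. 9); proof §5] -/
def theorem12 : Prop :=
  ∀ p : ℕ, p.Prime → p ≠ 2 → ((leadSigma8 ((p - 1) / 2) : ℕ) : ℤ) ≡ eta12TwoCoeff p [ZMOD ((p : ℤ) ^ 2)]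

/-- **Ahlgren 2001** (the Apéry numbers for `ζ(2)`; named fact, statement only, as restated in [MccarthyOsburnStraub2018, (1.2)]): for all
primes `p ≥ 5`, `a((p−1)/2) ≡ α(p) (mod p²)`, `a(n) = Σ_k binom(n,k)² binom(n+k,k)` (`apery2Number`), `η^6(4z) = Σ α(n) qⁿ`.
[cite: Ahlgren2001, main theorem; MccarthyOsburnStraub2018, eq. (1.2) (p. 3)] -/
def ahlgren2001_supercongruence : Prop :=
  ∀ p : ℕ, p.Prime → 5 ≤ p →
    ((Combinatorics.Enumerative.AperyNumbersZetaTwo.apery2Number ((p - 1) / 2) : ℕ) : ℤ) ≡ eta6FourCoeff p [ZMOD ((p : ℤ) ^ 2)]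

/-- **Ahlgren–Ono 2000** (the Apéry numbers for `ζ(3)`, a theorem answering a question of Beukers; named fact, statement only, as restated in
[MccarthyOsburnStraub2018, (1.3)]): for every odd prime `p`, `b((p−1)/2) ≡ β(p) (mod p²)`, `b(n) = Σ_k binom(n,k)² binom(n+k,k)²`
(`aperyNumber`), `η^4(2z)η^4(4z) = Σ β(n) qⁿ`. [cite: AhlgrenOno2000, Theorem 1; MccarthyOsburnStraub2018, eq. (1.3) (p. 3)] -/
def ahlgrenOno2000_supercongruence : Prop :=
  ∀ p : ℕ, p.Prime → p ≠ 2 →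
    ((Combinatorics.Enumerative.AperyNumbers.aperyNumber ((p - 1) / 2) : ℕ) : ℤ) ≡ eta44Coeff p [ZMOD ((p : ℤ) ^ 2)]

end Literature.NumberTheory.Irrationality.McCarthyOsburnStraub2020
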